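import Summits.Ventures.Crystal3D.Theorems.StickyWulffConstantCoaxialWallLawReachCoreOfRowsGen
import Summits.Ventures.Crystal3D.Theorems.StickyWulffConstantCoaxialWallLawTwoRowsCertified
import HarnessLib

/-!
# The crux `CoaxialWallLaw` from `P5Exhaustion` and the two v2 census rows, kissing facts CERTIFIED (computational)

HONEST FRAMING. Venture `Summits/Ventures/Crystal3D` (cell `crystal3d-full`), helper `--supports` the crux
`CoaxialWallLaw` of `route-Ventures-StickyWulffConstant` (REGISTERED line `WallLedgerF`).  Rung credit; F-C1 not
moved; CONDITIONAL on named facts; grade COMPUTATIONAL (imports the tree's certified `kissingGap_250`,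
`kissingClassification_250`, `StarFar.starPairFar_holds`, exactly as `…TwoRowsCertified`).  cf-p1 g28 (xxxviii″): the
census key is `WordVersion.v2`; lane F's by-name debts at that key are E1 (`P5Exhaustion`, cf-p2) and the two rows
`EndRowTwinHalfTurn v2 s_F`, `EndRowTrans v2 s_F` with `0 < s_F ≤ 2√6`.

* **`coaxialWallLaw_of_twoRows_v2_certified`** : `P5Exhaustion → 0 < s_F ≤ 2√6 → EndRowTwinHalfTurn v2 s_F →
  EndRowTrans v2 s_F → CoaxialWallLaw`;  `coaxialWallLaw_of_twoRows_certified_gen` — the same at any version `ver`.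
WHAT THIS IS NOT: the rows (census facts); F-C1 not moved.
-/

noncomputable section

namespace Summit.Ventures.Crystal3D.Theorems

open Summit.Ventures.Crystal3D

/-- **The crux from `P5Exhaustion` and the two census rows at any version, kissing facts certified.** -/
theorem coaxialWallLaw_of_twoRows_certified_gen (ver : WordVersion) (hE1 : P5Exhaustion) {sF : ℝ} (hsF : 0 < sF)
    (hsF' : sF ≤ 2 * Real.sqrt 6) (hrowW : EndRowTwinHalfTurn ver sF) (hrowT : EndRowTrans ver sF) :
    Summit.Ventures.Crystal3D.Theses.StickyWulffConstant.CoaxialWallLaw :=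
  coaxialWallLaw_of_twoRows_p5_gen ver kissingGap_250 kissingClassification_250 hsF hsF' hrowW hrowT hE1
    StarFar.starPairFar_holds

/-- **The crux from `P5Exhaustion` and the two `v2` census rows** — lane F's debts of record at the census key `v2`. -/
theorem coaxialWallLaw_of_twoRows_v2_certified (hE1 : P5Exhaustion) {sF : ℝ} (hsF : 0 < sF)
    (hsF' : sF ≤ 2 * Real.sqrt 6) (hrowW : EndRowTwinHalfTurn WordVersion.v2 sF)
    (hrowT : EndRowTrans WordVersion.v2 sF) :
    Summit.Ventures.Crystal3D.Theses.StickyWulffConstant.CoaxialWallLaw :=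
  coaxialWallLaw_of_twoRows_certified_gen WordVersion.v2 hE1 hsF hsF' hrowW hrowT

end Summit.Ventures.Crystal3D.Theorems

end
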